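import Mathlib
import HarnessLib
import Literature.MathematicalPhysics.KineticTheory.LangevinChainGibbs
import Literature.MathematicalPhysics.KineticTheory.PhaseSpacePoisson
import Literature.MathematicalPhysics.KineticTheory.MomentumHermiteLadder
import Summits.AtomisticToContinuum.FouriersLaw.Theses.LatticeLandauDamping

/-!
# `LatticeLandauDamping.LadderAdjoint` — `R†` is the Gibbs adjoint of `R` at finite `N`, proved

Item `stmt-AtomisticToContinuum-14016` (support, route `LatticeLandauDamping`, sub-problem
`FouriersLaw`). With `ρ = e^{-H/T}`, `R f = ∑_i (p_i ∂_{q_i} f - T ∂_{p_i}∂_{q_i} f)`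
(`momentumRaising`) and `R† g = ∑_i (-T ∂_{q_i}∂_{p_i} g + ∂_{q_i}H ∂_{p_i} g)`
(`OscillatorChain.momentumLowering`), for `C²` potentials, `T > 0` and `C²` compactly supported
`f, g`:

  `∫ (R f) g ρ = ∫ f (R† g) ρ`.

Proof (folklore Gaussian integration by parts, Risken 1996 §10.1.3 `D⁺ = -D̂`): site by site both
sides equal `T ∫ ∂_{q_i} f ∂_{p_i} g ρ` —
* raising side (`integral_raise_mul_gibbsDensity`): one integration by parts in `p_i`, using
  `∂_{p_i} ρ = -(p_i/T) ρ`, turns `-T ∫ (∂_{p_i}∂_{q_i} f) g ρ` into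
  `T ∫ ∂_{q_i} f ∂_{p_i} g ρ - ∫ p_i ∂_{q_i} f g ρ`;
* lowering side (`integral_mul_lower_gibbsDensity`): one integration by parts in `q_i`, using
  `∂_{q_i} ρ = -(∂_{q_i}H/T) ρ`, turns `-T ∫ f ∂_{q_i}∂_{p_i} g ρ` into
  `T ∫ ∂_{q_i} f ∂_{p_i} g ρ - ∫ f ∂_{q_i}H ∂_{p_i} g ρ`.
The one-direction integration by parts is the tree's `integral_mul_eq_neg_of_hasLineDerivAt`
(`LangevinChainGibbs.lean`, Mathlib's `integral_bilinear_hasLineDerivAt_right_eq_neg_left_of_integrable`).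
Only `g` needs compact support. The closing theorem is `latticeLandauDamping_ladderAdjoint_proof`.
-/

noncomputable section

open MeasureTheory Filter Set Function
open Literature.MathematicalPhysics.KineticTheory.HeatConduction

namespace Summit.AtomisticToContinuum.FouriersLaw.Theorems.LadderAdjoint

variable {N : ℕ} {P : OscillatorChain}

/-- Product rule along `(0, e_i)`: `∂_{p_i}(v ρ) = (∂_{p_i} v) ρ - v (p_i/T) ρ` for `ρ = e^{-H/T}`
(no hypothesis on the potentials: `∂_{p_i} H = p_i`). [folklore] -/
theorem hasLineDerivAt_mul_gibbsDensity_unitP {T : ℝ} {v : PhaseSpace N → ℝ}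
    (hv : Differentiable ℝ v) (i : Fin N) (x : PhaseSpace N) :
    HasLineDerivAt ℝ (fun y => v y * P.gibbsDensity N T y)
      (partialP i v x * P.gibbsDensity N T x - v x * (x.2 i / T) * P.gibbsDensity N T x)
      x ((0, Pi.single i 1) : PhaseSpace N) := by
  have h1 := hasLineDerivAt_partialP hv i x
  have h2 := P.hasLineDerivAt_gibbsDensity (T := T) (P.hasLineDerivAt_hamiltonian_unitP N x i)
  unfold HasLineDerivAt at h1 h2 ⊢
  refine (h1.mul h2).congr_deriv ?_
  simp only [zero_smul, add_zero]
  ring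

/-- Product rule along `(e_i, 0)`: `∂_{q_i}(u ρ) = (∂_{q_i} u) ρ - u (∂_{q_i}H/T) ρ` for
`ρ = e^{-H/T}` and a differentiable Hamiltonian. [folklore] -/
theorem hasLineDerivAt_mul_gibbsDensity_unitQ {T : ℝ} {u : PhaseSpace N → ℝ}
    (hu : Differentiable ℝ u) (hH : Differentiable ℝ (P.hamiltonian N)) (i : Fin N)
    (x : PhaseSpace N) :
    HasLineDerivAt ℝ (fun y => u y * P.gibbsDensity N T y)
      (partialQ i u x * P.gibbsDensity N T x -
        u x * (partialQ i (P.hamiltonian N) x / T) * P.gibbsDensity N T x)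
      x ((Pi.single i 1, 0) : PhaseSpace N) := by
  have h1 := hasLineDerivAt_partialQ hu i x
  have h2 := P.hasLineDerivAt_gibbsDensity (T := T) (P.hasLineDerivAt_hamiltonian_unitQ hH x i)
  unfold HasLineDerivAt at h1 h2 ⊢
  refine (h1.mul h2).congr_deriv ?_
  simp only [zero_smul, add_zero]
  ring

/-- **Raising side, one site.** For continuous potentials, `T ≠ 0`, `f ∈ C²` and `g ∈ C¹_c`:
`∫ (p_i ∂_{q_i} f - T ∂_{p_i}∂_{q_i} f) g ρ = T ∫ ∂_{q_i} f ∂_{p_i} g ρ` — one integration by parts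
in `p_i` against `ρ = e^{-H/T}` (`∂_{p_i} ρ = -(p_i/T) ρ`); the `i`-th term of `∫ (R f) g ρ`.
[cite: Risken1996, §10.1.3 eqs. (10.27)–(10.30)] [folklore] -/
theorem integral_raise_mul_gibbsDensity (hUc : Continuous P.U) (hVc : Continuous P.V) {T : ℝ}
    (hT : T ≠ 0) {f g : PhaseSpace N → ℝ} (hf : ContDiff ℝ 2 f) (hg : ContDiff ℝ 1 g)
    (hgc : HasCompactSupport g) (i : Fin N) :
    ∫ x, (x.2 i * partialQ i f x - T * partialP i (partialQ i f) x) * g x * P.gibbsDensity N T x =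
      T * ∫ x, partialQ i f x * partialP i g x * P.gibbsDensity N T x := by
  have hgd : Differentiable ℝ g := hg.differentiable one_ne_zero
  have hQ1 : ContDiff ℝ 1 (partialQ i f) := contDiff_partialQ hf (by norm_num) i
  have hQd : Differentiable ℝ (partialQ i f) := hQ1.differentiable one_ne_zero
  have hρc : Continuous (P.gibbsDensity N T) := P.continuous_gibbsDensity hUc hVc N T
  have hQc : Continuous (partialQ i f) := hQ1.continuous
  have hPQc : Continuous (partialP i (partialQ i f)) := continuous_partialP hQ1 one_ne_zero i
  have hPgc : Continuous (partialP i g) := continuous_partialP hg one_ne_zero i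
  have hpi : Continuous fun x : PhaseSpace N => x.2 i := (continuous_apply i).comp continuous_snd
  have hGc : Continuous fun y => g y * P.gibbsDensity N T y := hg.continuous.mul hρc
  have hG'c : Continuous fun y => partialP i g y * P.gibbsDensity N T y -
      g y * (y.2 i / T) * P.gibbsDensity N T y := by fun_prop
  have hGs : HasCompactSupport fun y => g y * P.gibbsDensity N T y := hgc.mul_right
  have hG's : HasCompactSupport fun y => partialP i g y * P.gibbsDensity N T y -
      g y * (y.2 i / T) * P.gibbsDensity N T y :=
    ((hasCompactSupport_partialP hgd hgc i).mul_right).sub (hgc.mul_right.mul_right)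
  -- `e : ∫ ∂_q f · ∂_p(g ρ) = -∫ (∂_p ∂_q f) · (g ρ)`
  have e := integral_mul_eq_neg_of_hasLineDerivAt (v := ((0, Pi.single i 1) : PhaseSpace N))
    hQc hPQc hGc hG'c hGs hG's (fun x => hasLineDerivAt_partialP hQd i x)
    (fun x => hasLineDerivAt_mul_gibbsDensity_unitP (P := P) (T := T) hgd i x)
  have e1 : ∫ x, partialQ i f x * (partialP i g x * P.gibbsDensity N T x -
      g x * (x.2 i / T) * P.gibbsDensity N T x) =
      (∫ x, partialQ i f x * partialP i g x * P.gibbsDensity N T x) -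
        T⁻¹ * ∫ x, x.2 i * partialQ i f x * g x * P.gibbsDensity N T x := by
    rw [← integral_const_mul, ← integral_sub]
    · congr 1
      funext x
      ring
    · exact ((hQc.mul hPgc).mul hρc).integrable_of_hasCompactSupport
        ((hasCompactSupport_partialP hgd hgc i).mul_left.mul_right)
    · refine Integrable.const_mul ?_ _
      exact (((hpi.mul hQc).mul hg.continuous).mul hρc).integrable_of_hasCompactSupport
        (hgc.mul_left.mul_right)
  rw [e1] at e
  have e2 : ∫ x, (x.2 i * partialQ i f x - T * partialP i (partialQ i f) x) * g x *
      P.gibbsDensity N T x =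
      (∫ x, x.2 i * partialQ i f x * g x * P.gibbsDensity N T x) -
        T * ∫ x, partialP i (partialQ i f) x * (g x * P.gibbsDensity N T x) := by
    rw [← integral_const_mul, ← integral_sub]
    · congr 1
      funext x
      ring
    · exact (((hpi.mul hQc).mul hg.continuous).mul hρc).integrable_of_hasCompactSupport
        (hgc.mul_left.mul_right)
    · refine Integrable.const_mul ?_ _
      exact (hPQc.mul hGc).integrable_of_hasCompactSupport hGs.mul_left
  have e3 : ∫ x, partialP i (partialQ i f) x * (g x * P.gibbsDensity N T x) =
      -((∫ x, partialQ i f x * partialP i g x * P.gibbsDensity N T x) -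
        T⁻¹ * ∫ x, x.2 i * partialQ i f x * g x * P.gibbsDensity N T x) := by
    linarith
  rw [e2, e3]
  field_simp
  ring

/-- **Lowering side, one site.** For `C¹` potentials, `T ≠ 0`, `f ∈ C¹` and `g ∈ C²_c`:
`∫ f (-T ∂_{q_i}∂_{p_i} g + ∂_{q_i}H ∂_{p_i} g) ρ = T ∫ ∂_{q_i} f ∂_{p_i} g ρ` — one integration by
parts in `q_i` against `ρ = e^{-H/T}` (`∂_{q_i} ρ = -(∂_{q_i}H/T) ρ`); the `i`-th term of
`∫ f (R† g) ρ`. [cite: Risken1996, §10.1.3 eqs. (10.27)–(10.30)] [folklore] -/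
theorem integral_mul_lower_gibbsDensity (hU : ContDiff ℝ 1 P.U) (hV : ContDiff ℝ 1 P.V) {T : ℝ}
    (hT : T ≠ 0) {f g : PhaseSpace N → ℝ} (hf : ContDiff ℝ 1 f) (hg : ContDiff ℝ 2 g)
    (hgc : HasCompactSupport g) (i : Fin N) :
    ∫ x, f x * (-(T * partialQ i (partialP i g) x) +
        partialQ i (P.hamiltonian N) x * partialP i g x) * P.gibbsDensity N T x =
      T * ∫ x, partialQ i f x * partialP i g x * P.gibbsDensity N T x := by
  have hH1 : ContDiff ℝ 1 (P.hamiltonian N) := P.contDiff_hamiltonian hU hV N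
  have hHd : Differentiable ℝ (P.hamiltonian N) := hH1.differentiable one_ne_zero
  have hfd : Differentiable ℝ f := hf.differentiable one_ne_zero
  have hgd : Differentiable ℝ g := hg.differentiable two_ne_zero
  have hP1 : ContDiff ℝ 1 (partialP i g) := contDiff_partialP hg (by norm_num) i
  have hPd : Differentiable ℝ (partialP i g) := hP1.differentiable one_ne_zero
  have hρc : Continuous (P.gibbsDensity N T) :=
    P.continuous_gibbsDensity hU.continuous hV.continuous N T
  have hWc : Continuous (partialQ i (P.hamiltonian N)) := P.continuous_partialQ_hamiltonian hH1 i
  have hQfc : Continuous (partialQ i f) := continuous_partialQ hf one_ne_zero i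
  have hPc : Continuous (partialP i g) := hP1.continuous
  have hQPc : Continuous (partialQ i (partialP i g)) := continuous_partialQ hP1 one_ne_zero i
  have hPs : HasCompactSupport (partialP i g) := hasCompactSupport_partialP hgd hgc i
  have hQPs : HasCompactSupport (partialQ i (partialP i g)) := hasCompactSupport_partialQ hPd hPs i
  have hFc : Continuous fun y => f y * P.gibbsDensity N T y := hf.continuous.mul hρc
  have hF'c : Continuous fun y => partialQ i f y * P.gibbsDensity N T y -
      f y * (partialQ i (P.hamiltonian N) y / T) * P.gibbsDensity N T y := by fun_prop
  -- `e : ∫ (f ρ) · ∂_q ∂_p g = -∫ ∂_q(f ρ) · ∂_p g`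
  have e := integral_mul_eq_neg_of_hasLineDerivAt (v := ((Pi.single i 1, 0) : PhaseSpace N))
    hFc hF'c hPc hQPc hPs hQPs
    (fun x => hasLineDerivAt_mul_gibbsDensity_unitQ (P := P) (T := T) hfd hHd i x)
    (fun x => hasLineDerivAt_partialQ hPd i x)
  have e1 : ∫ x, (partialQ i f x * P.gibbsDensity N T x -
      f x * (partialQ i (P.hamiltonian N) x / T) * P.gibbsDensity N T x) * partialP i g x =
      (∫ x, partialQ i f x * partialP i g x * P.gibbsDensity N T x) -
        T⁻¹ * ∫ x, f x * partialQ i (P.hamiltonian N) x * partialP i g x *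
          P.gibbsDensity N T x := by
    rw [← integral_const_mul, ← integral_sub]
    · congr 1
      funext x
      ring
    · exact ((hQfc.mul hPc).mul hρc).integrable_of_hasCompactSupport (hPs.mul_left.mul_right)
    · refine Integrable.const_mul ?_ _
      exact (((hf.continuous.mul hWc).mul hPc).mul hρc).integrable_of_hasCompactSupport
        (hPs.mul_left.mul_right)
  rw [e1] at e
  have e2 : ∫ x, f x * (-(T * partialQ i (partialP i g) x) +
      partialQ i (P.hamiltonian N) x * partialP i g x) * P.gibbsDensity N T x =
      (∫ x, f x * partialQ i (P.hamiltonian N) x * partialP i g x * P.gibbsDensity N T x) -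
        T * ∫ x, f x * P.gibbsDensity N T x * partialQ i (partialP i g) x := by
    rw [← integral_const_mul, ← integral_sub]
    · congr 1
      funext x
      ring
    · exact (((hf.continuous.mul hWc).mul hPc).mul hρc).integrable_of_hasCompactSupport
        (hPs.mul_left.mul_right)
    · refine Integrable.const_mul ?_ _
      exact (hFc.mul hQPc).integrable_of_hasCompactSupport hQPs.mul_left
  rw [e2, e]
  field_simp
  ring

/-- **`LadderAdjoint` (item `stmt-AtomisticToContinuum-14016`): `R†` is the `L²(e^{-H/T})`-adjoint
of `R` at finite `N`.** For every chain `P` with `C²` potentials, every `N`, `T > 0` and `C²`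
compactly supported `f, g`: `∫ (R f) g e^{-H/T} = ∫ f (R† g) e^{-H/T}`, both sides being
`T ∑_i ∫ ∂_{q_i} f ∂_{p_i} g e^{-H/T}` (`integral_raise_mul_gibbsDensity`,
`integral_mul_lower_gibbsDensity`, summed over the sites). Risken's `D⁺ = -D̂` (10.29)–(10.30) in the
observable picture, tensorised over the lattice. [cite: Risken1996, §10.1.3 eqs. (10.27)–(10.30)]
[folklore] -/
theorem latticeLandauDamping_ladderAdjoint_proof :
    Summit.AtomisticToContinuum.FouriersLaw.Theses.LatticeLandauDamping.LadderAdjoint := by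
  intro P N T hT hU hV f g hf _ hg hgc
  show ∫ x, momentumRaising T f x * g x * P.gibbsDensity N T x =
    ∫ x, f x * P.momentumLowering N T g x * P.gibbsDensity N T x
  have hT0 : T ≠ 0 := hT.ne'
  have hU1 : ContDiff ℝ 1 P.U := hU.of_le (by norm_num)
  have hV1 : ContDiff ℝ 1 P.V := hV.of_le (by norm_num)
  have hf1 : ContDiff ℝ 1 f := hf.of_le (by norm_num)
  have hg1 : ContDiff ℝ 1 g := hg.of_le (by norm_num)
  have hgd : Differentiable ℝ g := hg.differentiable two_ne_zero
  have hH1 : ContDiff ℝ 1 (P.hamiltonian N) := P.contDiff_hamiltonian hU1 hV1 N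
  have hρc : Continuous (P.gibbsDensity N T) :=
    P.continuous_gibbsDensity hU.continuous hV.continuous N T
  have hpi : ∀ i : Fin N, Continuous fun x : PhaseSpace N => x.2 i := fun i =>
    (continuous_apply i).comp continuous_snd
  -- the raising side, summed over the sites
  have hL : ∫ x, momentumRaising T f x * g x * P.gibbsDensity N T x =
      ∑ i : Fin N, T * ∫ x, partialQ i f x * partialP i g x * P.gibbsDensity N T x := by
    simp only [momentumRaising, Finset.sum_mul]
    rw [integral_finsetSum]
    · exact Finset.sum_congr rfl fun i _ =>
        integral_raise_mul_gibbsDensity hU.continuous hV.continuous hT0 hf hg1 hgc i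
    · intro i _
      have hQ1 : ContDiff ℝ 1 (partialQ i f) := contDiff_partialQ hf (by norm_num) i
      exact (((((hpi i).mul hQ1.continuous).sub
        (continuous_const.mul (continuous_partialP hQ1 one_ne_zero i))).mul hg.continuous).mul
          hρc).integrable_of_hasCompactSupport (hgc.mul_left.mul_right)
  -- the lowering side, summed over the sites
  have hR : ∫ x, f x * P.momentumLowering N T g x * P.gibbsDensity N T x =
      ∑ i : Fin N, T * ∫ x, partialQ i f x * partialP i g x * P.gibbsDensity N T x := by
    simp only [OscillatorChain.momentumLowering, Finset.mul_sum, Finset.sum_mul]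
    rw [integral_finsetSum]
    · exact Finset.sum_congr rfl fun i _ =>
        integral_mul_lower_gibbsDensity hU1 hV1 hT0 hf1 hg hgc i
    · intro i _
      have hP1 : ContDiff ℝ 1 (partialP i g) := contDiff_partialP hg (by norm_num) i
      have hPd : Differentiable ℝ (partialP i g) := hP1.differentiable one_ne_zero
      have hPs : HasCompactSupport (partialP i g) := hasCompactSupport_partialP hgd hgc i
      have hQPs : HasCompactSupport (partialQ i (partialP i g)) :=
        hasCompactSupport_partialQ hPd hPs i
      refine Continuous.integrable_of_hasCompactSupport ?_ ?_
      · exact (hf.continuous.mul (((continuous_const.mul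
          (continuous_partialQ hP1 one_ne_zero i)).neg).add
            ((P.continuous_partialQ_hamiltonian hH1 i).mul hP1.continuous))).mul hρc
      · exact ((hQPs.mul_left.neg.add hPs.mul_left).mul_left).mul_right
  rw [hL, hR]

end Summit.AtomisticToContinuum.FouriersLaw.Theorems.LadderAdjoint

end
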